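import Mathlib
import HarnessLib
import Summits.Ventures.LatticeQCDFlow.Exactness.U1WilsonFlowLOContinuity
import Summits.Ventures.LatticeQCDFlow.Exactness.U1WilsonFlowLOSmooth
import Summits.Ventures.LatticeQCDFlow.Exactness.U1MemberGaugeCovariance
import Summits.Ventures.LatticeQCDFlow.Exactness.SU2AcceptanceLatticeTranslation

/-!
# Non-vacuity on the STEP-0 `U(1)` configuration: the 2-d `L × L` torus (`L` even), parity masks, the sweep schedule `(μ, even), (μ, odd)`, `2|ε| < 1`, `S = β·S_W` — FT-HMC through the LO member with the EXACT force commutes with every gauge transformation and every even translation, its pulled-back action is continuous and differentiable along the drift; nothing left to assume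

HONEST FRAMING: exact (Metropolis-corrected) sampling algorithms for lattice gauge theory;
figures of merit are autocorrelation/cost numbers at stated couplings and volumes; no
continuum-physics claim.

Venture `LatticeQCDFlow` (cell pub-lqcd), topic `Exactness`; FANOUT row 14 (`eng-flowhmc`, `U(1)` rung
= the STEP-0 configuration of rows 3 / 4: 2-d `U(1)` on `L × L`, `L` even; member `maps.u1_wilson_flow_lo`
with parity masks and the sweep schedule `(0, even), (0, odd), (1, even), (1, odd)` per sweep).  NEW
WORK of the cell; nothing is cited as a fact; no number.  The `U(1)` twin of the 4⁴ `SU(2)` files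
(`SU2AcceptanceLatticeExactForce`, `SU2AcceptanceLatticeTranslationExactForce`): INSTANTIATION of the
member-level theorems of this GEN (`U1WilsonFlowLOContinuity`, `U1WilsonFlowLOSmooth`,
`U1WilsonFlowLOTranslation`) and GEN-9/10 (`U1MemberGaugeCovariance`, `U1FTHMCGaugeCovariance`) at that
configuration, with an ADDITIVE parity colouring (`exists_additive_properMask`).

* `length_u1Schedule_two` — the schedule has `4 · nsweeps` sub-steps;
* **`u1_fthmc_stepZeroLattice_wilson_exactForce`** — for every even `L`, `2|ε| < 1`, `nsweeps`, `β`: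
  there is an additive parity colouring `χ` of the 2-d torus and a list of `4·nsweeps` certified
  layers whose maps / densities ARE the masked `U(1)` Wilson-flow sub-steps / booked Jacobians of the
  schedule (formulas VERBATIM as in `exists_layers_u1WilsonFlowLO`) such that, with `S = β·S_W`
  (defining representation `u1Rep`): (i) `S̃ = β S_W∘F − log J` is continuous; (ii) `S̃` is
  differentiable along the drift at every momentum, for every drift constant and field (the autodiff
  force is a true derivative); (iii) for every gauge transformation `h`, FT-HMC with the EXACT
  gradient force commutes with `Θ_h`; (iv) for every EVEN translation `t` (`χ t = 0`) it commutes with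
  `Θ_t` — NOTHING left to assume but `L` even and `2|ε| < 1`.

NOT CLAIMED: odd translations; `τ_int` / acceptance numbers of the STEP-0 runs; floating point; any
number.
-/

noncomputable section

namespace Summit.Ventures.LatticeQCDFlow.Exactness

open Set MeasureTheory
open ProbabilityTheory ProbabilityTheory.Kernel
open Literature.MathematicalPhysics.QuantumFieldTheory Literature.MathematicalPhysics.QuantumLattice
open Literature.Barriers.QuantumFields
open scoped ENNReal

/-- The 2-d sweep schedule has `4 · nsweeps` sub-steps. -/
theorem length_u1Schedule_two (nsweeps : ℕ) :
    ((List.replicate nsweeps ((List.finRange 2).flatMap fun μ : Fin 2 => [(μ, (0 : ZMod 2)), (μ, 1)])).flatten).length = 4 * nsweeps := by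
  simp [List.length_flatten, List.length_flatMap, mul_comm]

/-- **STEP-0 `U(1)` configuration (2-d, `L` even, parity masks, sweep schedule, `2|ε| < 1`, `S = β·S_W`,
EXACT force): continuity, differentiability, gauge covariance and even-translation covariance of the
FT-HMC kernel through the LO member — nothing left to assume** (see the module docstring). -/
theorem u1_fthmc_stepZeroLattice_wilson_exactForce {L : ℕ} [NeZero L] (hL : Even L) {ε : ℝ}
    (hε : |ε| * 2 < 1) (nsweeps : ℕ) (β : ℝ) :
    ∃ χ : Site 2 L → ZMod 2, (∀ (x : Site 2 L) (i : Fin 2), χ (x.shift i) ≠ χ x) ∧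
      (∀ x y : Site 2 L, χ (x + y) = χ x + χ y) ∧
    ∃ layers : List ((GaugeConfig 2 L Circle ≃ᵐ GaugeConfig 2 L Circle) × (GaugeConfig 2 L Circle → ℝ)),
      layers.map (fun Ly => ((Ly.1 : GaugeConfig 2 L Circle → GaugeConfig 2 L Circle), Ly.2)) = ((List.replicate nsweeps ((List.finRange 2).flatMap fun μ : Fin 2 => [(μ, (0 : ZMod 2)), (μ, 1)])).flatten).map (fun s =>
        ((fun (V : GaugeConfig 2 L Circle) (e : Edge 2 L) => if e.2 = s.1 ∧ χ e.1 = s.2 then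
          V e * Circle.exp (ε * ∑ ν ∈ Finset.univ.erase e.2,
            (((plaquetteHolonomy V (e.1 - Pi.single ν 1) e.2 ν : Circle) : ℂ).im -
              ((plaquetteHolonomy V e.1 e.2 ν : Circle) : ℂ).im)) else V e),
         fun V : GaugeConfig 2 L Circle => ∏ a : {e : Edge 2 L // e.2 = s.1 ∧ χ e.1 = s.2},
          (1 - ε * ∑ ν ∈ Finset.univ.erase a.1.2,
            (((plaquetteHolonomy V a.1.1 a.1.2 ν : Circle) : ℂ).re +
              ((plaquetteHolonomy V (a.1.1 - Pi.single ν 1) a.1.2 ν : Circle) : ℂ).re)))) ∧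
      layers.length = 4 * nsweeps ∧
      (Continuous fun W : GaugeConfig 2 L Circle => β * wilsonAction u1Rep ((layers.foldr (fun Ly (F : GaugeConfig 2 L Circle ≃ᵐ GaugeConfig 2 L Circle) => Ly.1.trans F) (MeasurableEquiv.refl (GaugeConfig 2 L Circle))) W) - Real.log ((layers.foldr (fun Ly K => fun v => Ly.2 v * K (Ly.1 v)) (fun _ => (1 : ℝ))) W)) ∧
      (∀ (c : ℝ) (V : GaugeConfig 2 L Circle) (p₀ : (Edge 2 L → ℝ)), DifferentiableAt ℝ (fun p : (Edge 2 L → ℝ) =>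
        (fun W : GaugeConfig 2 L Circle => β * wilsonAction u1Rep ((layers.foldr (fun Ly (F : GaugeConfig 2 L Circle ≃ᵐ GaugeConfig 2 L Circle) => Ly.1.trans F) (MeasurableEquiv.refl (GaugeConfig 2 L Circle))) W) - Real.log ((layers.foldr (fun Ly K => fun v => Ly.2 v * K (Ly.1 v)) (fun _ => (1 : ℝ))) W)) ((fun i : Edge 2 L => Circle.exp (c * p i)) * V)) p₀) ∧
      (∀ (h : Site 2 L → Circle)
        (hSc : Continuous fun W : GaugeConfig 2 L Circle => β * wilsonAction u1Rep ((layers.foldr (fun Ly (F : GaugeConfig 2 L Circle ≃ᵐ GaugeConfig 2 L Circle) => Ly.1.trans F) (MeasurableEquiv.refl (GaugeConfig 2 L Circle))) W) - Real.log ((layers.foldr (fun Ly K => fun v => Ly.2 v * K (Ly.1 v)) (fun _ => (1 : ℝ))) W)) (c κ : ℝ) (n : ℕ),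
    conjKernel
      (conjKernel
        (refreshUpdate
          (involMH
            (⇑((flip : Equiv.Perm (GaugeConfig 2 L Circle × (Edge 2 L → ℝ))) *
                leapfrog (mulDrift (fun p : Edge 2 L → ℝ => fun i : Edge 2 L => Circle.exp (c * p i))) (fun V : GaugeConfig 2 L Circle => (fun i : Edge 2 L => κ * fderiv ℝ (fun p : (Edge 2 L → ℝ) => (fun W : GaugeConfig 2 L Circle => β * wilsonAction u1Rep ((layers.foldr (fun Ly (F : GaugeConfig 2 L Circle ≃ᵐ GaugeConfig 2 L Circle) => Ly.1.trans F) (MeasurableEquiv.refl (GaugeConfig 2 L Circle))) W) - Real.log ((layers.foldr (fun Ly K => fun v => Ly.2 v * K (Ly.1 v)) (fun _ => (1 : ℝ))) W)) ((fun i : Edge 2 L => Circle.exp (c * p i)) * V)) 0 (Pi.single i 1))) ^ n))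
            (measurable_flip_leapfrog_pow (measurable_mulDrift (measurable_circleDrift c)) (measurable_u1ExactForce hSc c κ) n)
            fun z : GaugeConfig 2 L Circle × (Edge 2 L → ℝ) =>
              (β * wilsonAction u1Rep ((layers.foldr (fun Ly (F : GaugeConfig 2 L Circle ≃ᵐ GaugeConfig 2 L Circle) => Ly.1.trans F) (MeasurableEquiv.refl (GaugeConfig 2 L Circle))) z.1) - Real.log ((layers.foldr (fun Ly K => fun v => Ly.2 v * K (Ly.1 v)) (fun _ => (1 : ℝ))) z.1)) + ∑ i, z.2 i ^ 2 / 2)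
          ((((volume : Measure (Edge 2 L → ℝ)).withDensity
                  fun p => ENNReal.ofReal (Real.exp (-(∑ i, p i ^ 2 / 2)))) Set.univ)⁻¹ •
              (volume : Measure (Edge 2 L → ℝ)).withDensity
                fun p => ENNReal.ofReal (Real.exp (-(∑ i, p i ^ 2 / 2)))))
        (layers.foldr (fun Ly (F : GaugeConfig 2 L Circle ≃ᵐ GaugeConfig 2 L Circle) => Ly.1.trans F) (MeasurableEquiv.refl (GaugeConfig 2 L Circle))))
      (Elitzur.gaugeTransformMEquiv h) =
      (conjKernel
        (refreshUpdate
          (involMH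
            (⇑((flip : Equiv.Perm (GaugeConfig 2 L Circle × (Edge 2 L → ℝ))) *
                leapfrog (mulDrift (fun p : Edge 2 L → ℝ => fun i : Edge 2 L => Circle.exp (c * p i))) (fun V : GaugeConfig 2 L Circle => (fun i : Edge 2 L => κ * fderiv ℝ (fun p : (Edge 2 L → ℝ) => (fun W : GaugeConfig 2 L Circle => β * wilsonAction u1Rep ((layers.foldr (fun Ly (F : GaugeConfig 2 L Circle ≃ᵐ GaugeConfig 2 L Circle) => Ly.1.trans F) (MeasurableEquiv.refl (GaugeConfig 2 L Circle))) W) - Real.log ((layers.foldr (fun Ly K => fun v => Ly.2 v * K (Ly.1 v)) (fun _ => (1 : ℝ))) W)) ((fun i : Edge 2 L => Circle.exp (c * p i)) * V)) 0 (Pi.single i 1))) ^ n))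
            (measurable_flip_leapfrog_pow (measurable_mulDrift (measurable_circleDrift c)) (measurable_u1ExactForce hSc c κ) n)
            fun z : GaugeConfig 2 L Circle × (Edge 2 L → ℝ) =>
              (β * wilsonAction u1Rep ((layers.foldr (fun Ly (F : GaugeConfig 2 L Circle ≃ᵐ GaugeConfig 2 L Circle) => Ly.1.trans F) (MeasurableEquiv.refl (GaugeConfig 2 L Circle))) z.1) - Real.log ((layers.foldr (fun Ly K => fun v => Ly.2 v * K (Ly.1 v)) (fun _ => (1 : ℝ))) z.1)) + ∑ i, z.2 i ^ 2 / 2)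
          ((((volume : Measure (Edge 2 L → ℝ)).withDensity
                  fun p => ENNReal.ofReal (Real.exp (-(∑ i, p i ^ 2 / 2)))) Set.univ)⁻¹ •
              (volume : Measure (Edge 2 L → ℝ)).withDensity
                fun p => ENNReal.ofReal (Real.exp (-(∑ i, p i ^ 2 / 2)))))
        (layers.foldr (fun Ly (F : GaugeConfig 2 L Circle ≃ᵐ GaugeConfig 2 L Circle) => Ly.1.trans F) (MeasurableEquiv.refl (GaugeConfig 2 L Circle))))) ∧
      ∀ (t : Site 2 L) (_ht : χ t = 0)
        (hSc : Continuous fun W : GaugeConfig 2 L Circle => β * wilsonAction u1Rep ((layers.foldr (fun Ly (F : GaugeConfig 2 L Circle ≃ᵐ GaugeConfig 2 L Circle) => Ly.1.trans F) (MeasurableEquiv.refl (GaugeConfig 2 L Circle))) W) - Real.log ((layers.foldr (fun Ly K => fun v => Ly.2 v * K (Ly.1 v)) (fun _ => (1 : ℝ))) W)) (c κ : ℝ) (n : ℕ),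
    conjKernel
      (conjKernel
        (refreshUpdate
          (involMH
            (⇑((flip : Equiv.Perm (GaugeConfig 2 L Circle × (Edge 2 L → ℝ))) *
                leapfrog (mulDrift (fun p : Edge 2 L → ℝ => fun i : Edge 2 L => Circle.exp (c * p i))) (fun V : GaugeConfig 2 L Circle => (fun i : Edge 2 L => κ * fderiv ℝ (fun p : (Edge 2 L → ℝ) => (fun W : GaugeConfig 2 L Circle => β * wilsonAction u1Rep ((layers.foldr (fun Ly (F : GaugeConfig 2 L Circle ≃ᵐ GaugeConfig 2 L Circle) => Ly.1.trans F) (MeasurableEquiv.refl (GaugeConfig 2 L Circle))) W) - Real.log ((layers.foldr (fun Ly K => fun v => Ly.2 v * K (Ly.1 v)) (fun _ => (1 : ℝ))) W)) ((fun i : Edge 2 L => Circle.exp (c * p i)) * V)) 0 (Pi.single i 1))) ^ n))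
            (measurable_flip_leapfrog_pow (measurable_mulDrift (measurable_circleDrift c)) (measurable_u1ExactForce hSc c κ) n)
            fun z : GaugeConfig 2 L Circle × (Edge 2 L → ℝ) =>
              (β * wilsonAction u1Rep ((layers.foldr (fun Ly (F : GaugeConfig 2 L Circle ≃ᵐ GaugeConfig 2 L Circle) => Ly.1.trans F) (MeasurableEquiv.refl (GaugeConfig 2 L Circle))) z.1) - Real.log ((layers.foldr (fun Ly K => fun v => Ly.2 v * K (Ly.1 v)) (fun _ => (1 : ℝ))) z.1)) + ∑ i, z.2 i ^ 2 / 2)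
          ((((volume : Measure (Edge 2 L → ℝ)).withDensity
                  fun p => ENNReal.ofReal (Real.exp (-(∑ i, p i ^ 2 / 2)))) Set.univ)⁻¹ •
              (volume : Measure (Edge 2 L → ℝ)).withDensity
                fun p => ENNReal.ofReal (Real.exp (-(∑ i, p i ^ 2 / 2)))))
        (layers.foldr (fun Ly (F : GaugeConfig 2 L Circle ≃ᵐ GaugeConfig 2 L Circle) => Ly.1.trans F) (MeasurableEquiv.refl (GaugeConfig 2 L Circle))))
      ({ toFun := fun V : GaugeConfig 2 L Circle => (fun e : Edge 2 L => V (e.1 + t, e.2)),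
         invFun := fun V : GaugeConfig 2 L Circle => (fun e : Edge 2 L => V (e.1 - t, e.2)),
         left_inv := fun V => funext fun e => by simp only [sub_add_cancel],
         right_inv := fun V => funext fun e => by simp only [add_sub_cancel_right],
         measurable_toFun := measurable_pi_lambda _ fun e => measurable_pi_apply _,
         measurable_invFun := measurable_pi_lambda _ fun e => measurable_pi_apply _ } : GaugeConfig 2 L Circle ≃ᵐ GaugeConfig 2 L Circle) =
      (conjKernel
        (refreshUpdate
          (involMH
            (⇑((flip : Equiv.Perm (GaugeConfig 2 L Circle × (Edge 2 L → ℝ))) *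
                leapfrog (mulDrift (fun p : Edge 2 L → ℝ => fun i : Edge 2 L => Circle.exp (c * p i))) (fun V : GaugeConfig 2 L Circle => (fun i : Edge 2 L => κ * fderiv ℝ (fun p : (Edge 2 L → ℝ) => (fun W : GaugeConfig 2 L Circle => β * wilsonAction u1Rep ((layers.foldr (fun Ly (F : GaugeConfig 2 L Circle ≃ᵐ GaugeConfig 2 L Circle) => Ly.1.trans F) (MeasurableEquiv.refl (GaugeConfig 2 L Circle))) W) - Real.log ((layers.foldr (fun Ly K => fun v => Ly.2 v * K (Ly.1 v)) (fun _ => (1 : ℝ))) W)) ((fun i : Edge 2 L => Circle.exp (c * p i)) * V)) 0 (Pi.single i 1))) ^ n))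
            (measurable_flip_leapfrog_pow (measurable_mulDrift (measurable_circleDrift c)) (measurable_u1ExactForce hSc c κ) n)
            fun z : GaugeConfig 2 L Circle × (Edge 2 L → ℝ) =>
              (β * wilsonAction u1Rep ((layers.foldr (fun Ly (F : GaugeConfig 2 L Circle ≃ᵐ GaugeConfig 2 L Circle) => Ly.1.trans F) (MeasurableEquiv.refl (GaugeConfig 2 L Circle))) z.1) - Real.log ((layers.foldr (fun Ly K => fun v => Ly.2 v * K (Ly.1 v)) (fun _ => (1 : ℝ))) z.1)) + ∑ i, z.2 i ^ 2 / 2)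
          ((((volume : Measure (Edge 2 L → ℝ)).withDensity
                  fun p => ENNReal.ofReal (Real.exp (-(∑ i, p i ^ 2 / 2)))) Set.univ)⁻¹ •
              (volume : Measure (Edge 2 L → ℝ)).withDensity
                fun p => ENNReal.ofReal (Real.exp (-(∑ i, p i ^ 2 / 2)))))
        (layers.foldr (fun Ly (F : GaugeConfig 2 L Circle ≃ᵐ GaugeConfig 2 L Circle) => Ly.1.trans F) (MeasurableEquiv.refl (GaugeConfig 2 L Circle)))) := by
  obtain ⟨χ, hχ, hadd⟩ := exists_additive_properMask (d := 2) (L := L) (w := 2) (by decide) (even_iff_two_dvd.mp hL)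
  have hε' : |ε| * (2 * ((2 - 1 : ℕ) : ℝ)) < 1 := by norm_num; linarith
  obtain ⟨layers, hmap, hpos, hmeas, -⟩ := exists_layers_u1WilsonFlowLO χ hχ hε'
    ((List.replicate nsweeps ((List.finRange 2).flatMap fun μ : Fin 2 => [(μ, (0 : ZMod 2)), (μ, 1)])).flatten)
  have hSc0 : Continuous fun U : GaugeConfig 2 L Circle => β * wilsonAction u1Rep U :=
    continuous_const.mul (Elitzur.continuous_wilsonAction _ continuous_u1Rep)
  have hSi : IsGaugeInvariant fun U : GaugeConfig 2 L Circle => β * wilsonAction u1Rep U :=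
    fun g U => by simp only [wilsonAction_gaugeTransform]
  have hgauge := u1WilsonFlowLO_member_gauge χ ε _ layers hmap
  have heven : ∀ t : Site 2 L, χ t = 0 → ∀ x : Site 2 L, χ (x + t) = χ x := fun t ht x => by
    rw [hadd, ht, add_zero]
  refine ⟨χ, hχ, hadd, layers, hmap, ?_, ?_, ?_, ?_, ?_⟩
  · have hl := congrArg List.length hmap
    rw [List.length_map, List.length_map, length_u1Schedule_two] at hl
    exact hl
  · exact u1WilsonFlowLO_member_ftAction_continuous χ ε _ layers hmap hpos hSc0
  · intro c V p₀
    exact differentiableAt_ftAction_u1WilsonFlowLO_drift χ ε _ layers hmap hpos β c V p₀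
  · intro h hSW c κ n
    exact u1_fthmc_exactForce_conjKernel_gaugeTransform h _ hgauge.1 (measurable_foldr_logDet layers hmeas)
      hgauge.2 hSc0.measurable hSi hSW c κ n
  · intro t ht hSW c κ n
    have hm := u1WilsonFlowLO_member_translate χ t (heven t ht) ε _ layers hmap
    have hSt : ∀ V : GaugeConfig 2 L Circle, (fun U : GaugeConfig 2 L Circle => β * wilsonAction u1Rep U) (fun e : Edge 2 L => V (e.1 + t, e.2)) = (fun U : GaugeConfig 2 L Circle => β * wilsonAction u1Rep U) V :=
      fun V => by
        beta_reduce
        rw [wilsonAction_comp_translate]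
    exact u1_fthmc_exactForce_conjKernel_translate t _ hm.1 (measurable_foldr_logDet layers hmeas) hm.2
      hSc0.measurable hSt hSW c κ n

end Summit.Ventures.LatticeQCDFlow.Exactness
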